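import Literature.NumberTheory.Sieve.IwaniecAlmostPrimesQuadraticLemma4
import Literature.NumberTheory.Sieve.IwaniecAlmostPrimesQuadraticWCount
import Literature.NumberTheory.Sieve.IwaniecAlmostPrimesVW
import HarnessLib

/-!
# Iwaniec (1978) for a general quadratic `G`: the linear model of the window counts, `U`, and the evaluations of `V` and `W` — PROVED

H. Iwaniec, *Almost-primes represented by quadratic polynomials*, Invent. Math. **47** (1978)
171–188, §4 pp. 179–184 (proof of Proposition 1: Lemma 4 packaged as a linear model, the sums
`U`, `V`, `W` of the dispersion `𝒟 = W − 2xV + x²U`), for the sequence `𝒜_G`,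
`G = aX² + bX + c` (`a > 0`, `c` odd, `G` irreducible); R. J. Lemke Oliver, Acta Arith. **151**
(2012), §3 and (2.12)–(2.15).  General-`G` copy of `IwaniecAlmostPrimesLinearModel.lean` and
`IwaniecAlmostPrimesVW.lean` in one file (sixteenth file of the inline proof of
`theorem_quadratic`).  Everything here is PROVED from the hypothesis `rootExpSumBoundG a b c`
(the root exponential sums of Lemma 4, a predicate with parameters,
`IwaniecAlmostPrimesQuadraticLemma4.lean`); no named facts.

Part 1 — the linear model (`IwaniecAlmostPrimesLinearModel.lean` for `G`):
* `mvErrG` (the error of the mean value of `ρ_G`, `abs_rhoSumAPG_sub_le`, monotone in `Y`);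
* `windowCount_linearG` — for `ε > 0` there are `C, Cmv ≥ 0`, `K ≥ 1` with
  `|P_c(A,t) − (1/q) ρ_G(q/d) (κ_G/φ(d)) (t − A)| ≤ 4ρ_G(q/d) Σ₀(t)/A^{1/4}
   + C d K^{ω(Q)} (1 + log 16A)² S^{1/2+ε} S + (2/q) ρ_G(q/d) · 2·mvErrG(t)` for `Q` squarefree,
  `q ∣ Q`, `d ∣ q` with `(d, 2aΔ) = 1`, `(μ,d) = 1`, `G(ω) ≡ 0 (d)`, `2 ≤ A ≤ t`, `c < q`,
  `E, T ≥ 1`, `TE ≤ A` (`κ_G = kappaG a b c Q E T`);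
* `windowErrG`, `windowErrG_mono`, `windowSum_inv_linearG` (the same with the weight `1/m`),
  `usum_linearG` (`U` against `κ_G ∑ 1/m²`).

Part 2 — `V` and `W` (`IwaniecAlmostPrimesVW.lean` for `G`), for one pair `(n₁, n₂)` of squarefree
moduli and `Msf = {A' < m ≤ B₀ : (m, n₁ n₂) = 1}` with `A' ≥ |c|` (so that `Θ = 0` is never a
root of `G` modulo `m` or `mn`, `G(0) = c`, and the lower sandwiches of
`IwaniecAlmostPrimesQuadraticDispersion.lean` hold without correction,
`sum_wcountG_le_congrCountG_of_not_dvd`, `le_sum_xcountG_mul_of_not_dvd`):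
* `vsum_boundsG` — `V(n)` two-sidedly against `e κ_G ∑_m ⌊X/m⌋/m` (`e = ρ_G(n)/n`);
* `rhoG_prime_le_two`, `rhoG_le_card_divisors_of_squarefree`, `wErrG`, `gfunG`
  (`g_G(l₁,l₂) = [(d₂, 2a) = 1, (d₂, Δ) = 1]/φ(d₂)`, `d₂ = d/(d, |l₁−l₂|)`: the admissible classes
  modulo `d₂` are `ρ_G(d₂)` in number when `(d₂, Δ) = 1` and none otherwise, and the count
  vanishes unless `(d₂, 2a) = 1`), `sum_wpairG_linear`;
* `wsum_boundsG` — `W(n₁, n₂)` two-sidedly against `(ρ_G(q)/q) κ_G ∑_m ∑_{l₁,l₂} g_G(l₁,l₂)`.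

## References

* H. Iwaniec, Invent. Math. 47 (1978) 171–188, §4 Lemma 4, (12)–(14), pp. 181–184 (`IwaniecInventiones1978`).
* R. J. Lemke Oliver, Acta Arith. 151 (2012) 241–261, §3, (2.12)–(2.15) (`LemkeOliverActaArith2012`).
-/

noncomputable section

open Finset Real

namespace Literature.NumberTheory.Sieve.Iwaniec1978

variable {a b c : ℤ}

/-! ## Part 1: the linear model of the window counts -/



/-! ### The mean-value error and its monotonicity -/

/-- The error of the mean value of `ρ_G` (`abs_rhoSumAPG_sub_le`) as a function of `Y`:
`Cmv τ(Q) (log₂ Y + 1)^{ω(D₀)+1} (E + Y/√E + Y/T)`. [folklore] -/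
def mvErrG (a b c : ℤ) (Cmv : ℝ) (Q Y E T : ℕ) : ℝ :=
  Cmv * Q.divisors.card * ((Nat.log 2 Y : ℝ) + 1) ^ ((badMod a b c).primeFactors.card + 1) *
    (E + Y / Real.sqrt E + Y / T)

/-- `mvErrG` is monotone in `Y` (for `Cmv ≥ 0`). [folklore] -/
theorem mvErrG_mono {Cmv : ℝ} (hC : 0 ≤ Cmv) (Q E T : ℕ) {Y Y' : ℕ} (h : Y ≤ Y') :
    mvErrG a b c Cmv Q Y E T ≤ mvErrG a b c Cmv Q Y' E T := by
  unfold mvErrG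
  have h1 : ((Nat.log 2 Y : ℝ) + 1) ≤ (Nat.log 2 Y' : ℝ) + 1 := by
    have := Nat.log_mono_right (b := 2) h
    exact_mod_cast Nat.add_le_add_right this 1
  have h2 : (Y : ℝ) / Real.sqrt E ≤ (Y' : ℝ) / Real.sqrt E :=
    div_le_div_of_nonneg_right (by exact_mod_cast h) (Real.sqrt_nonneg _)
  have h3 : (Y : ℝ) / T ≤ (Y' : ℝ) / T := div_le_div_of_nonneg_right (by exact_mod_cast h) (Nat.cast_nonneg _)
  have h0 : (0 : ℝ) ≤ (Nat.log 2 Y : ℝ) + 1 := by positivity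
  gcongr

/-- `0 ≤ mvErrG` (for `Cmv ≥ 0`). [folklore] -/
theorem mvErrG_nonneg {Cmv : ℝ} (hC : 0 ≤ Cmv) (Q Y E T : ℕ) : 0 ≤ mvErrG a b c Cmv Q Y E T := by
  unfold mvErrG; positivity

/-! ### The linear model of the window counts -/

/-- **The window count for `𝒜_G` with its linear model** (Lemma 4 for `𝒜_G` + the total count +
the mean value of `ρ_G`): assuming `rootExpSumBoundG a b c`, for `ε > 0` there are `C, Cmv ≥ 0` and
`K ≥ 1` such that for `Q` squarefree, `q ∣ Q`, `d ∣ q` with `(d, D₀) = 1`, `(μ, d) = 1`,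
`G(ω) ≡ 0 (mod d)`, `2 ≤ A ≤ t`, `c < q`, `E, T ≥ 1`, `TE ≤ A`:
`|P_c(A, t) − (1/q) ρ_G(q/d) (κ_G/φ(d)) (t − A)| ≤ 4ρ_G(q/d) Σ₀(t)/A^{1/4}
   + C d K^{ω(Q)} (1 + log 16A)² S^{1/2+ε} S + (2/q) ρ_G(q/d) · 2·mvErrG(t)`,
`S = ⌊√(tq)⌋`, `Σ₀(t) = rhoSumAPG t Q d μ`, `κ_G = kappaG a b c Q E T`.
[cite: IwaniecInventiones1978, Lemma 4] -/
theorem windowCount_linearG (h4 : rootExpSumBoundG a b c) (ha : 0 < a) (hc : Odd c)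
    (hirr : Irreducible (quadPoly a b c)) {ε : ℝ} (hε : 0 < ε) :
    ∃ C K Cmv : ℝ, 0 ≤ C ∧ 1 ≤ K ∧ 0 ≤ Cmv ∧ ∀ (q Q d μ ω A t cc E T : ℕ), Squarefree Q → q ∣ Q → d ∣ q →
      d.Coprime (badMod a b c) → μ.Coprime d → (d : ℤ) ∣ quadVal a b c ω → 2 ≤ A → A ≤ t → cc < q →
      1 ≤ E → 1 ≤ T → T * E ≤ A →
      |(windowCountG a b c q Q d μ ω A t cc : ℝ) -
          1 / q * (rhoG a b c (q / d) : ℝ) * (kappaG a b c Q E T / Nat.totient d) * ((t : ℝ) - A)| ≤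
        4 * (rhoG a b c (q / d) : ℝ) * (rhoSumAPG a b c t Q d μ : ℝ) / (A : ℝ) ^ (1 / 4 : ℝ) +
          C * d * K ^ Q.primeFactors.card * (1 + Real.log (16 * A)) ^ 2 *
            ((Nat.sqrt (t * q) : ℝ) ^ (1 / 2 + ε) * Nat.sqrt (t * q)) +
          2 / q * (rhoG a b c (q / d) : ℝ) * (2 * mvErrG a b c Cmv Q t E T) := by
  obtain ⟨C, K, hC0, hK1, hC⟩ := lemma4_windowG h4 hε
  obtain ⟨Cmv, hCmv0, hmv⟩ := abs_rhoSumAPG_sub_le ha hc hirr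
  refine ⟨C, K, Cmv, hC0, hK1, hCmv0, ?_⟩
  intro q Q d μ ω A t cc E T hQ hqQ hdq hdD hμ hω hA hAt hcq hE hT hTEA
  have hQ0 : Q ≠ 0 := hQ.ne_zero
  have hq : 0 < q := Nat.pos_of_dvd_of_pos hqQ (Nat.pos_of_ne_zero hQ0)
  have hd : 0 < d := Nat.pos_of_dvd_of_pos hdq hq
  have hdQ : d ∣ Q := hdq.trans hqQ
  have hq' : (0 : ℝ) < q := by exact_mod_cast hq
  have hA0 : (0 : ℝ) < A := by exact_mod_cast (by omega : 0 < A)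
  set fam := lemma4FamilyG a b c q Q d μ ω A t with hfam
  -- the window as a condition on the fraction
  set α : ℝ := (cc : ℝ) / q with hα
  set β : ℝ := ((cc : ℝ) + 1) / q with hβ
  have hα0 : 0 ≤ α := by rw [hα]; positivity
  have hαβ : α ≤ β := by rw [hα, hβ]; gcongr; linarith
  have hβ1 : β ≤ 1 := by
    rw [hβ, div_le_one hq']
    have : cc + 1 ≤ q := hcq
    exact_mod_cast this
  have hβα : β - α = 1 / q := by rw [hα, hβ]; field_simp; ring
  have hwin : (windowCountG a b c q Q d μ ω A t cc : ℝ) =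
      ((fam.filter (fun p : ℕ × ℕ => α ≤ (p.2 : ℝ) / (p.1 * q) ∧ (p.2 : ℝ) / (p.1 * q) < β)).card : ℝ) := by
    unfold windowCountG
    congr 2
    refine Finset.filter_congr fun p hp => ?_
    rw [mem_lemma4FamilyG] at hp
    have hm : 0 < p.1 := by omega
    rw [hα, hβ, window_iff_div_eq hm hq]
  -- Lemma 4 for `𝒜_G`
  have hL4 := hC q Q d μ ω A t α β hQ hqQ hdq hA hα0 hαβ hβ1
  rw [hβα] at hL4
  -- the total count and the mean value
  have hcard := card_lemma4FamilyG_eq (a := a) (b := b) (c := c) (μ := μ) hQ hqQ hdq hω hAt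
  have hTEt : T * E ≤ t := hTEA.trans hAt
  have hmt := hmv Q d μ t E T hQ hdQ hdD hμ hE hT hTEt
  have hmA := hmv Q d μ A E T hQ hdQ hdD hμ hE hT hTEA
  -- monotonicity of the mean-value error in `Y`
  set Δ : ℝ := mvErrG a b c Cmv Q t E T with hΔ
  have hmt' : |(rhoSumAPG a b c t Q d μ : ℝ) - kappaG a b c Q E T / Nat.totient d * t| ≤ Δ := by
    rw [hΔ]; unfold mvErrG; exact hmt
  have hmA' : |(rhoSumAPG a b c A Q d μ : ℝ) - kappaG a b c Q E T / Nat.totient d * A| ≤ Δ := by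
    refine hmA.trans ?_
    have := mvErrG_mono (a := a) (b := b) (c := c) hCmv0 Q E T hAt
    rw [hΔ]; unfold mvErrG at this ⊢; exact this
  -- assembling
  set P : ℝ := (fam.card : ℝ) with hP
  set W : ℝ := (windowCountG a b c q Q d μ ω A t cc : ℝ) with hW
  set κd : ℝ := kappaG a b c Q E T / Nat.totient d with hκd
  set ρ' : ℝ := (rhoG a b c (q / d) : ℝ) with hρ'
  have hρ'0 : 0 ≤ ρ' := Nat.cast_nonneg _
  have hP' : P = ρ' * ((rhoSumAPG a b c t Q d μ : ℝ) - (rhoSumAPG a b c A Q d μ : ℝ)) := hcard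
  have hdiff : |((rhoSumAPG a b c t Q d μ : ℝ) - (rhoSumAPG a b c A Q d μ : ℝ)) - κd * ((t : ℝ) - A)| ≤ 2 * Δ := by
    have e : ((rhoSumAPG a b c t Q d μ : ℝ) - (rhoSumAPG a b c A Q d μ : ℝ)) - κd * ((t : ℝ) - A) =
        ((rhoSumAPG a b c t Q d μ : ℝ) - κd * t) - ((rhoSumAPG a b c A Q d μ : ℝ) - κd * A) := by ring
    rw [e]
    refine (abs_sub _ _).trans ?_
    have h1 : |(rhoSumAPG a b c t Q d μ : ℝ) - κd * t| ≤ Δ := by rw [hκd]; exact hmt'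
    have h2 : |(rhoSumAPG a b c A Q d μ : ℝ) - κd * A| ≤ Δ := by rw [hκd]; exact hmA'
    linarith
  have hPle : P ≤ ρ' * (rhoSumAPG a b c t Q d μ : ℝ) := by
    rw [hP']
    have : (0 : ℝ) ≤ (rhoSumAPG a b c A Q d μ : ℝ) := Nat.cast_nonneg _
    nlinarith
  have hP0 : 0 ≤ P := Nat.cast_nonneg _
  rw [← hwin] at hL4
  have hsplit : W - 1 / q * ρ' * κd * ((t : ℝ) - A) =
      (W - 1 / q * P) + 1 / q * ρ' * (((rhoSumAPG a b c t Q d μ : ℝ) - (rhoSumAPG a b c A Q d μ : ℝ)) -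
        κd * ((t : ℝ) - A)) := by rw [hP']; ring
  rw [hsplit]
  refine (abs_add_le _ _).trans ?_
  have hterm2 : |1 / q * ρ' * (((rhoSumAPG a b c t Q d μ : ℝ) - (rhoSumAPG a b c A Q d μ : ℝ)) -
        κd * ((t : ℝ) - A))| ≤ 2 / q * ρ' * (2 * Δ) := by
    rw [abs_mul, abs_of_nonneg (by positivity : (0 : ℝ) ≤ 1 / q * ρ')]
    calc 1 / q * ρ' * |((rhoSumAPG a b c t Q d μ : ℝ) - (rhoSumAPG a b c A Q d μ : ℝ)) - κd * ((t : ℝ) - A)|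
        ≤ 1 / q * ρ' * (2 * Δ) := mul_le_mul_of_nonneg_left hdiff (by positivity)
      _ ≤ 2 / q * ρ' * (2 * Δ) := by
          have hΔ0 : 0 ≤ Δ := by rw [hΔ]; exact mvErrG_nonneg hCmv0 Q t E T
          have : 1 / (q : ℝ) * ρ' ≤ 2 / q * ρ' := by
            apply mul_le_mul_of_nonneg_right _ hρ'0
            exact div_le_div_of_nonneg_right (by norm_num) hq'.le
          exact mul_le_mul_of_nonneg_right this (by positivity)
  have hterm1 : |W - 1 / q * P| ≤ 4 * ρ' * (rhoSumAPG a b c t Q d μ : ℝ) / (A : ℝ) ^ (1 / 4 : ℝ) +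
      C * d * K ^ Q.primeFactors.card * (1 + Real.log (16 * A)) ^ 2 *
        ((Nat.sqrt (t * q) : ℝ) ^ (1 / 2 + ε) * Nat.sqrt (t * q)) := by
    refine hL4.trans ?_
    have hA4 : 0 < (A : ℝ) ^ (1 / 4 : ℝ) := Real.rpow_pos_of_pos hA0 _
    have : 4 * P / (A : ℝ) ^ (1 / 4 : ℝ) ≤ 4 * ρ' * (rhoSumAPG a b c t Q d μ : ℝ) / (A : ℝ) ^ (1 / 4 : ℝ) := by
      refine div_le_div_of_nonneg_right ?_ hA4.le
      linarith
    linarith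
  linarith

/-! ### The error term and the weighted version of the linear model -/

/-- The error term of the linear model for `𝒜_G`, as a function of the data (monotone in `t`).
[cite: IwaniecInventiones1978, Lemma 4] -/
def windowErrG (a b c : ℤ) (C K Cmv ε : ℝ) (q Q d μ A t E T : ℕ) : ℝ :=
  4 * (rhoG a b c (q / d) : ℝ) * (rhoSumAPG a b c t Q d μ : ℝ) / (A : ℝ) ^ (1 / 4 : ℝ) +
    C * d * K ^ Q.primeFactors.card * (1 + Real.log (16 * A)) ^ 2 *
      ((Nat.sqrt (t * q) : ℝ) ^ (1 / 2 + ε) * Nat.sqrt (t * q)) +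
    2 / q * (rhoG a b c (q / d) : ℝ) * (2 * mvErrG a b c Cmv Q t E T)

/-- `rhoSumAPG` is monotone in its length. [folklore] -/
theorem rhoSumAPG_mono {Y Y' : ℕ} (h : Y ≤ Y') (Q d μ : ℕ) :
    rhoSumAPG a b c Y Q d μ ≤ rhoSumAPG a b c Y' Q d μ := by
  unfold rhoSumAPG
  refine Finset.sum_le_sum_of_subset_of_nonneg ?_ fun _ _ _ => Nat.zero_le _
  exact Finset.filter_subset_filter _ (Finset.Ioc_subset_Ioc_right h)

/-- `windowErrG` is monotone in `t` (for `C, Cmv ≥ 0`, `K ≥ 1`, `ε ≥ 0`). [folklore] -/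
theorem windowErrG_mono {C K Cmv ε : ℝ} (hC : 0 ≤ C) (hK : 1 ≤ K) (hCmv : 0 ≤ Cmv) (hε : 0 ≤ ε)
    {q Q d μ A t t' E T : ℕ} (htt' : t ≤ t') :
    windowErrG a b c C K Cmv ε q Q d μ A t E T ≤ windowErrG a b c C K Cmv ε q Q d μ A t' E T := by
  unfold windowErrG
  have h1 : (rhoSumAPG a b c t Q d μ : ℝ) ≤ rhoSumAPG a b c t' Q d μ := by
    exact_mod_cast rhoSumAPG_mono htt' Q d μ
  have h2 : (Nat.sqrt (t * q) : ℝ) ≤ Nat.sqrt (t' * q) := by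
    exact_mod_cast Nat.sqrt_le_sqrt (Nat.mul_le_mul_right q htt')
  have h3 : (Nat.sqrt (t * q) : ℝ) ^ (1 / 2 + ε) ≤ (Nat.sqrt (t' * q) : ℝ) ^ (1 / 2 + ε) :=
    Real.rpow_le_rpow (Nat.cast_nonneg _) h2 (by linarith)
  have h4 : mvErrG a b c Cmv Q t E T ≤ mvErrG a b c Cmv Q t' E T := mvErrG_mono hCmv Q E T htt'
  have hA : 0 ≤ (A : ℝ) ^ (1 / 4 : ℝ) := Real.rpow_nonneg (Nat.cast_nonneg _) _
  have hK0 : 0 ≤ K ^ Q.primeFactors.card := pow_nonneg (by linarith) _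
  gcongr

/-- **The weighted linear model for `𝒜_G`**: with the data of `windowCount_linearG`,
`|∑_{(m,Θ) ∈ window c} 1/m − (1/q) ρ_G(q/d)(κ_G/φ(d)) ∑_{A<m≤t} 1/m| ≤ windowErrG(t)/(A+1)`
(Abel summation in `m`; the linear-model error is monotone in `t`).
[cite: IwaniecInventiones1978, §4 p. 182] -/
theorem windowSum_inv_linearG (h4 : rootExpSumBoundG a b c) (ha : 0 < a) (hc : Odd c)
    (hirr : Irreducible (quadPoly a b c)) {ε : ℝ} (hε : 0 < ε) :
    ∃ C K Cmv : ℝ, 0 ≤ C ∧ 1 ≤ K ∧ 0 ≤ Cmv ∧ ∀ (q Q d μ ω A t cc E T : ℕ), Squarefree Q → q ∣ Q → d ∣ q →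
      d.Coprime (badMod a b c) → μ.Coprime d → (d : ℤ) ∣ quadVal a b c ω → 2 ≤ A → A ≤ t → cc < q →
      1 ≤ E → 1 ≤ T → T * E ≤ A →
      (|(windowCountG a b c q Q d μ ω A t cc : ℝ) -
          1 / q * (rhoG a b c (q / d) : ℝ) * (kappaG a b c Q E T / Nat.totient d) * ((t : ℝ) - A)| ≤
        windowErrG a b c C K Cmv ε q Q d μ A t E T) ∧
      |∑ p ∈ (lemma4FamilyG a b c q Q d μ ω A t).filter (fun p : ℕ × ℕ => p.2 / p.1 = cc), (1 : ℝ) / p.1 -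
          1 / q * (rhoG a b c (q / d) : ℝ) * (kappaG a b c Q E T / Nat.totient d) *
            ∑ m ∈ Finset.Ioc A t, (1 : ℝ) / m| ≤
        windowErrG a b c C K Cmv ε q Q d μ A t E T / (A + 1) := by
  obtain ⟨C, K, Cmv, hC0, hK1, hCmv0, hC⟩ := windowCount_linearG h4 ha hc hirr hε
  refine ⟨C, K, Cmv, hC0, hK1, hCmv0, ?_⟩
  intro q Q d μ ω A t cc E T hQ hqQ hdq hdD hμ hω hA hAt hcq hE hT hTEA
  have hmain : ∀ t' : ℕ, A ≤ t' → t' ≤ t →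
      |(windowCountG a b c q Q d μ ω A t' cc : ℝ) -
          1 / q * (rhoG a b c (q / d) : ℝ) * (kappaG a b c Q E T / Nat.totient d) * ((t' : ℝ) - A)| ≤
        windowErrG a b c C K Cmv ε q Q d μ A t E T := by
    intro t' hAt' ht't
    have h := hC q Q d μ ω A t' cc E T hQ hqQ hdq hdD hμ hω hA hAt' hcq hE hT hTEA
    exact h.trans (windowErrG_mono hC0 hK1 hCmv0 hε.le ht't)
  refine ⟨hmain t hAt le_rfl, ?_⟩
  set lam : ℝ := 1 / q * (rhoG a b c (q / d) : ℝ) * (kappaG a b c Q E T / Nat.totient d) with hlam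
  have hws := sum_window_familyG_eq (a := a) (b := b) (c := c) q Q d μ ω A t cc (fun m => (1 : ℝ) / m)
  rw [hws]
  have hErr0 : 0 ≤ windowErrG a b c C K Cmv ε q Q d μ A t E T := (abs_nonneg _).trans (hmain A le_rfl hAt)
  have habel := abs_sum_Ioc_mul_sub_le (a := fun m => (windowFibreG a b c q Q d μ ω cc m : ℝ))
    (f := fun m => (1 : ℝ) / m) (lam := lam) (A := A) (t := t) hErr0 ?_ ?_ ?_
  · have e : windowErrG a b c C K Cmv ε q Q d μ A t E T * (1 / ((A + 1 : ℕ) : ℝ)) =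
        windowErrG a b c C K Cmv ε q Q d μ A t E T / (A + 1) := by push_cast; ring
    rw [e] at habel
    exact habel
  · intro t' hAt' ht't
    rw [← windowCountG_eq_sum_windowFibreG]
    exact hmain t' hAt' ht't
  · intro m hm _
    have hm0 : (0 : ℝ) < m := by exact_mod_cast (by omega : 0 < m)
    gcongr
    norm_num
  · intro m hm
    positivity

/-! ### The evaluation of `U` -/

/-- **`U = ∑_{(m,Q)=1} ρ_G(m)/m²` against its linear model**: for `Q` squarefree, `A ≤ B`,
`E, T ≥ 1` with `TE ≤ A`:
`|∑_{A<m≤B, (m,Q)=1} ρ_G(m)/m² − κ_G ∑_{A<m≤B} 1/m²| ≤ 2 · mvErrG(B)·/(A+1)²` — with the constant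
`Cmv` of `abs_rhoSumAPG_sub_le` (Abel summation of the mean value of `ρ_G` with `d = 1`).
[cite: IwaniecInventiones1978, §4 p. 181] -/
theorem usum_linearG (ha : 0 < a) (hc : Odd c) (hirr : Irreducible (quadPoly a b c)) :
    ∃ Cmv : ℝ, 0 ≤ Cmv ∧ ∀ (Q A B E T : ℕ), Squarefree Q → A ≤ B → 1 ≤ E → 1 ≤ T → T * E ≤ A →
      |∑ m ∈ (Finset.Ioc A B).filter (fun m : ℕ => m.Coprime Q), (rhoG a b c m : ℝ) / (m : ℝ) ^ 2 -
          kappaG a b c Q E T * ∑ m ∈ Finset.Ioc A B, (1 : ℝ) / (m : ℝ) ^ 2| ≤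
        2 * mvErrG a b c Cmv Q B E T / ((A : ℝ) + 1) ^ 2 := by
  obtain ⟨Cmv, hCmv0, hmvb⟩ := abs_rhoSumAPG_sub_le ha hc hirr
  refine ⟨Cmv, hCmv0, ?_⟩
  intro Q A B E T hQ hAB hE hT hTEA
  set Δ : ℝ := mvErrG a b c Cmv Q B E T with hΔ
  have hΔ0 : 0 ≤ Δ := by rw [hΔ]; exact mvErrG_nonneg hCmv0 Q B E T
  -- the indicator-weighted sequence and its partial sums
  set w : ℕ → ℝ := fun m => if m.Coprime Q then (rhoG a b c m : ℝ) else 0 with hw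
  have hfil : ∀ Y : ℕ, (rhoSumAPG a b c Y Q 1 0 : ℝ) = ∑ m ∈ Finset.Ioc 0 Y, w m := by
    intro Y
    unfold rhoSumAPG
    rw [Nat.cast_sum, Finset.sum_filter]
    refine Finset.sum_congr rfl fun m _ => ?_
    have h1 : m ≡ 0 [MOD 1] := Nat.modEq_one
    by_cases h : m.Coprime Q
    · rw [if_pos ⟨h, h1⟩, hw]; simp only [if_pos h]
    · rw [if_neg (fun h' => h h'.1), hw]; simp only [if_neg h]
  have hpartial : ∀ t' : ℕ, A ≤ t' →
      ∑ m ∈ Finset.Ioc A t', w m = (rhoSumAPG a b c t' Q 1 0 : ℝ) - (rhoSumAPG a b c A Q 1 0 : ℝ) := by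
    intro t' hAt'
    have hsplit : Finset.Ioc 0 t' = Finset.Ioc 0 A ∪ Finset.Ioc A t' :=
      (Finset.Ioc_union_Ioc_eq_Ioc (Nat.zero_le A) hAt').symm
    have hdisj : Disjoint (Finset.Ioc 0 A) (Finset.Ioc A t') :=
      Finset.disjoint_left.mpr fun x hx hx' => by rw [Finset.mem_Ioc] at hx hx'; omega
    rw [hfil, hfil, hsplit, Finset.sum_union hdisj]
    ring
  -- the mean value with `d = 1`, `μ = 0`
  have hmv : ∀ Y : ℕ, T * E ≤ Y → Y ≤ B →
      |(rhoSumAPG a b c Y Q 1 0 : ℝ) - kappaG a b c Q E T * Y| ≤ Δ := by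
    intro Y hY hYB
    have h := hmvb Q 1 0 Y E T hQ (one_dvd Q) (Nat.coprime_one_left _) (Nat.coprime_one_right 0) hE hT hY
    rw [Nat.totient_one, Nat.cast_one, div_one] at h
    refine h.trans ?_
    rw [hΔ]; exact mvErrG_mono hCmv0 Q E T hYB
  have hlin : ∀ t' : ℕ, A ≤ t' → t' ≤ B →
      |∑ m ∈ Finset.Ioc A t', w m - kappaG a b c Q E T * ((t' : ℝ) - A)| ≤ 2 * Δ := by
    intro t' hAt' ht'B
    rw [hpartial t' hAt']
    have h1 := hmv t' (hTEA.trans hAt') ht'B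
    have h2 := hmv A hTEA hAB
    have e : ((rhoSumAPG a b c t' Q 1 0 : ℝ) - (rhoSumAPG a b c A Q 1 0 : ℝ)) - kappaG a b c Q E T * ((t' : ℝ) - A) =
        ((rhoSumAPG a b c t' Q 1 0 : ℝ) - kappaG a b c Q E T * t') -
          ((rhoSumAPG a b c A Q 1 0 : ℝ) - kappaG a b c Q E T * A) := by ring
    rw [e]
    refine (abs_sub _ _).trans ?_
    linarith
  have habel := abs_sum_Ioc_mul_sub_le (a := w) (f := fun m => (1 : ℝ) / (m : ℝ) ^ 2)
    (lam := kappaG a b c Q E T) (A := A) (t := B) (E := 2 * Δ) (by positivity) hlin ?_ ?_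
  · have hlhs : ∑ m ∈ (Finset.Ioc A B).filter (fun m : ℕ => m.Coprime Q), (rhoG a b c m : ℝ) / (m : ℝ) ^ 2 =
        ∑ m ∈ Finset.Ioc A B, w m * (1 / (m : ℝ) ^ 2) := by
      rw [Finset.sum_filter]
      refine Finset.sum_congr rfl fun m _ => ?_
      by_cases h : m.Coprime Q
      · simp only [hw, if_pos h]; ring
      · simp only [hw, if_neg h]; ring
    rw [hlhs]
    refine habel.trans (le_of_eq ?_)
    push_cast
    ring
  · intro m hm _
    have hm0 : (0 : ℝ) < m := by exact_mod_cast (by omega : 0 < m)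
    gcongr
    norm_num
  · intro m hm
    positivity


/-! ## Part 2: the evaluations of `V` and `W` -/



/-! ### The lower sandwiches without correction when `m ∤ c` -/

/-- If `m ∤ c` then `0` is not a root of `G` modulo `mn` (`G(0) = c`). [folklore] -/
theorem pos_of_mem_rootsG_of_not_dvd {m n Θ : ℕ} (h0 : ¬ (m : ℤ) ∣ c) (hΘ : Θ ∈ rootsG a b c (m * n)) :
    1 ≤ Θ := by
  rcases Nat.eq_zero_or_pos Θ with rfl | hpos
  · exfalso
    rw [mem_rootsG] at hΘ
    apply h0
    have h := hΘ.2
    simp only [quadVal, Nat.cast_zero] at h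
    have h' : ((m * n : ℕ) : ℤ) ∣ c := by simpa using h
    push_cast at h'
    exact (dvd_mul_right (m : ℤ) n).trans h'
  · exact hpos

/-- **Lower sandwich for `V` without correction**: for `m ∤ c`,
`∑_{0 ≤ l < X/m} #{Θ : ⌊Θ/m⌋ = l mod n} ≤ |𝒜_{mn}|` (the tree's injection lands in `[1, x]`).
[cite: IwaniecInventiones1978, §4 p. 182] -/
theorem sum_wcountG_le_congrCountG_of_not_dvd (x : ℝ) {m n : ℕ} (hm : 0 < m) (hn : 0 < n)
    (h0 : ¬ (m : ℤ) ∣ c) :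
    ∑ l ∈ Finset.range (⌊x⌋₊ / m), wcountG a b c m n (l % n) ≤ congrCountG a b c x (m * n) := by
  classical
  rw [congrCountG_eq]
  set X := ⌊x⌋₊
  have hmn : 0 < m * n := Nat.mul_pos hm hn
  unfold wcountG
  rw [← card_filter_product_eq_sum (Finset.range (X / m)) (rootsG a b c (m * n))
    (fun l Θ => Θ / m = l % n)]
  refine Finset.card_le_card_of_injOn (fun p => p.2 + m * n * (p.1 / n)) ?_ ?_
  · intro p hp
    rw [Finset.mem_coe, Finset.mem_filter, Finset.mem_product, Finset.mem_range] at hp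
    obtain ⟨⟨hl, hΘmem⟩, hdiv⟩ := hp
    have hΘpos : 1 ≤ p.2 := pos_of_mem_rootsG_of_not_dvd h0 hΘmem
    rw [mem_rootsG] at hΘmem
    obtain ⟨hΘlt, hΘroot⟩ := hΘmem
    rw [Finset.mem_coe, Finset.mem_filter, Finset.mem_Icc]
    have hΘ' : p.2 < m * (p.1 % n) + m := by
      have e := Nat.div_add_mod p.2 m
      have hr := Nat.mod_lt p.2 hm
      rw [hdiv] at e
      omega
    have e1 : m * n * (p.1 / n) + m * (p.1 % n) = m * p.1 := by
      rw [mul_assoc, ← mul_add, Nat.div_add_mod]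
    have hkX : p.2 + m * n * (p.1 / n) ≤ X := by
      have h1 : p.2 + m * n * (p.1 / n) < m * (p.1 + 1) := by
        calc p.2 + m * n * (p.1 / n) < (m * (p.1 % n) + m) + m * n * (p.1 / n) :=
              Nat.add_lt_add_right hΘ' _
          _ = m * (p.1 + 1) := by linarith [e1]
      have hl' : p.1 + 1 ≤ X / m := hl
      calc p.2 + m * n * (p.1 / n) ≤ m * (p.1 + 1) := h1.le
        _ ≤ m * (X / m) := Nat.mul_le_mul_left m hl'
        _ ≤ X := Nat.mul_div_le X m
    refine ⟨⟨le_trans hΘpos (Nat.le_add_right _ _), hkX⟩, ?_⟩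
    have hmod : (p.2 + m * n * (p.1 / n)) % (m * n) = p.2 % (m * n) := Nat.add_mul_mod_self_left _ _ _
    rw [Nat.mod_eq_of_lt hΘlt] at hmod
    refine dvd_gAbs_iff.2 (dvd_quadVal_of_modEq ?_ hΘroot)
    have := natCast_mod_modEq (p.2 + m * n * (p.1 / n)) (m * n)
    rw [hmod] at this
    exact_mod_cast this
  · intro p hp p' hp' h
    rw [Finset.mem_coe, Finset.mem_filter, Finset.mem_product, Finset.mem_range, mem_rootsG] at hp hp'
    simp only at h
    have hΘ : p.2 = p'.2 := by
      have e1 : (p.2 + m * n * (p.1 / n)) % (m * n) = p.2 := by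
        rw [Nat.add_mul_mod_self_left, Nat.mod_eq_of_lt hp.1.2.1]
      have e2 : (p'.2 + m * n * (p'.1 / n)) % (m * n) = p'.2 := by
        rw [Nat.add_mul_mod_self_left, Nat.mod_eq_of_lt hp'.1.2.1]
      rw [← e1, ← e2, h]
    have hq : p.1 / n = p'.1 / n := by
      have e1 : (p.2 + m * n * (p.1 / n)) / (m * n) = p.1 / n := by
        rw [Nat.add_mul_div_left _ _ hmn, Nat.div_eq_of_lt hp.1.2.1, zero_add]
      have e2 : (p'.2 + m * n * (p'.1 / n)) / (m * n) = p'.1 / n := by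
        rw [Nat.add_mul_div_left _ _ hmn, Nat.div_eq_of_lt hp'.1.2.1, zero_add]
      rw [← e1, ← e2, h]
    have hl : p.1 = p'.1 := by
      rw [← Nat.div_add_mod p.1 n, ← Nat.div_add_mod p'.1 n, hq, ← hp.2, ← hp'.2, hΘ]
    exact Prod.ext hl hΘ

/-- **Lower sandwich for `W` without correction**: for `m ∤ c`,
`∑_{l₁, l₂ < X/m} wpairG(m; l₁, l₂) ≤ ∑_v X₁X₂` (`v ≥ 1` for the roots `v` of `G` mod `m`).
[cite: IwaniecInventiones1978, §4 p. 183] -/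
theorem le_sum_xcountG_mul_of_not_dvd (X : ℕ) {m : ℕ} (hm : 0 < m) (h0 : ¬ (m : ℤ) ∣ c) (n₁ n₂ : ℕ) :
    ∑ l₁ ∈ Finset.range (X / m), ∑ l₂ ∈ Finset.range (X / m), wpairG a b c m n₁ n₂ l₁ l₂ ≤
      ∑ v ∈ rootsG a b c m, xcountG a b c X n₁ m v * xcountG a b c X n₂ m v := by
  classical
  rw [sum_xcountG_mul_eq_card]
  unfold wpairG
  rw [← card_filter_product_product_eq_sum (Finset.range (X / m)) (Finset.range (X / m))
    (rootsG a b c m) (fun l₁ l₂ v => n₁ ∣ gAbs a b c (v + m * l₁) ∧ n₂ ∣ gAbs a b c (v + m * l₂))]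
  refine Finset.card_le_card_of_injOn (fun t => (t.2 + m * t.1.1, t.2 + m * t.1.2)) ?_ ?_
  · intro t ht
    rw [Finset.mem_coe, Finset.mem_filter, Finset.mem_product, Finset.mem_product, Finset.mem_range,
      Finset.mem_range] at ht
    obtain ⟨⟨⟨hl1, hl2⟩, hvmem⟩, h1n, h2n⟩ := ht
    have hvpos : 1 ≤ t.2 := by
      have : t.2 ∈ rootsG a b c (m * 1) := by rw [mul_one]; exact hvmem
      exact pos_of_mem_rootsG_of_not_dvd h0 this
    rw [mem_rootsG] at hvmem
    obtain ⟨hvlt, hvroot⟩ := hvmem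
    have hbound : ∀ l, l < X / m → t.2 + m * l ≤ X := by
      intro l hl
      have hl' : l + 1 ≤ X / m := hl
      calc t.2 + m * l ≤ m + m * l := by omega
        _ = m * (l + 1) := by ring
        _ ≤ m * (X / m) := Nat.mul_le_mul_left m hl'
        _ ≤ X := Nat.mul_div_le X m
    have hmod : ∀ l, (t.2 + m * l) % m = t.2 := by
      intro l; rw [Nat.add_mul_mod_self_left, Nat.mod_eq_of_lt hvlt]
    rw [Finset.mem_coe, Finset.mem_filter, Finset.mem_product, Finset.mem_Icc, Finset.mem_Icc]
    simp only
    refine ⟨⟨⟨le_trans hvpos (Nat.le_add_right _ _), hbound _ hl1⟩,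
      ⟨le_trans hvpos (Nat.le_add_right _ _), hbound _ hl2⟩⟩, ?_, ?_, h1n, h2n⟩
    · rw [hmod, mem_rootsG]; exact ⟨hvlt, hvroot⟩
    · rw [hmod, hmod]
  · intro t ht t' ht' h
    rw [Finset.mem_coe, Finset.mem_filter, Finset.mem_product, Finset.mem_product, Finset.mem_range,
      Finset.mem_range, mem_rootsG] at ht ht'
    simp only [Prod.mk.injEq] at h
    obtain ⟨h1, h2⟩ := h
    have hv : t.2 = t'.2 := by
      have e := congrArg (· % m) h1
      simp only [Nat.add_mul_mod_self_left, Nat.mod_eq_of_lt ht.1.2.1,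
        Nat.mod_eq_of_lt ht'.1.2.1] at e
      exact e
    rw [hv] at h1 h2
    have hl1 : t.1.1 = t'.1.1 := Nat.eq_of_mul_eq_mul_left hm (Nat.add_left_cancel h1)
    have hl2 : t.1.2 = t'.1.2 := Nat.eq_of_mul_eq_mul_left hm (Nat.add_left_cancel h2)
    exact Prod.ext (Prod.ext hl1 hl2) hv

/-! ### The window fibres with `d = 1` -/

/-- With `d = 1`, `μ = ω = 0`: `windowFibreG q Q 1 0 0 c m = [(m,Q)=1] · wcountG m q c`. [folklore] -/
theorem windowFibreG_one (q Q cc m : ℕ) :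
    windowFibreG a b c q Q 1 0 0 cc m = if m.Coprime Q then wcountG a b c m q cc else 0 := by
  unfold windowFibreG wcountG
  by_cases h : m.Coprime Q
  · rw [if_pos ⟨h, Nat.modEq_one⟩, if_pos h]
    congr 1
    exact Finset.filter_congr fun Θ _ => ⟨fun hh => hh.2, fun hh => ⟨Nat.modEq_one, hh⟩⟩
  · rw [if_neg (fun hh => h hh.1), if_neg h]

/-- The `l`-th layer of `V` as a weighted window sum over the family with `d = 1`. [folklore] -/
theorem sum_wcountG_div_eq_familyG (q Q A t cc : ℕ) :
    ∑ m ∈ (Finset.Ioc A t).filter (fun m : ℕ => m.Coprime Q), (wcountG a b c m q cc : ℝ) / m =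
      ∑ p ∈ (lemma4FamilyG a b c q Q 1 0 0 A t).filter (fun p : ℕ × ℕ => p.2 / p.1 = cc), (1 : ℝ) / p.1 := by
  have h := sum_window_familyG_eq (a := a) (b := b) (c := c) q Q 1 0 0 A t cc (fun m => (1 : ℝ) / m)
  rw [h, Finset.sum_filter]
  refine Finset.sum_congr rfl fun m _ => ?_
  rw [windowFibreG_one]
  split_ifs <;> simp [div_eq_mul_inv]

/-! ### The evaluation of `V` -/

/-- **`V` against its main term, upper and lower bounds** (p. 182, (13)–(14), in the `m`-first
form), for `𝒜_G`: with `Msf = {A' < m ≤ B₀ : (m, Q) = 1}`, `e = ρ_G(n)/n`, `κ = kappaG Q E T`,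
`Err = windowErrG … n Q 1 0 A' B₀ E T`, `L = ⌊X/(A'+1)⌋`, and `A' ≥ |c|`:
`vsumG X Msf n ≤ e κ ∑_{A'<m≤B₀} (⌊X/m⌋+1)/m + (L+1) Err/(A'+1)` and
`e κ ∑_{A'<m≤B₀} ⌊X/m⌋/m − (L+1) Err/(A'+1) ≤ vsumG X Msf n`.
[cite: IwaniecInventiones1978, §4 p. 182] -/
theorem vsum_boundsG (h4 : rootExpSumBoundG a b c) (ha : 0 < a) (hc : Odd c)
    (hirr : Irreducible (quadPoly a b c)) {ε : ℝ} (hε : 0 < ε) :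
    ∃ C K Cmv : ℝ, 0 ≤ C ∧ 1 ≤ K ∧ 0 ≤ Cmv ∧ ∀ (X n Q A' B₀ E T : ℕ), Squarefree Q → n ∣ Q → 2 ≤ A' → A' ≤ B₀ →
      c.natAbs ≤ A' → 1 ≤ E → 1 ≤ T → T * E ≤ A' →
      (vsumG a b c X ((Finset.Ioc A' B₀).filter (fun m : ℕ => m.Coprime Q)) n ≤
          (rhoG a b c n : ℝ) / n * kappaG a b c Q E T * ∑ m ∈ Finset.Ioc A' B₀, (((X / m + 1 : ℕ) : ℝ)) / m +
            ((X / (A' + 1) + 1 : ℕ) : ℝ) * windowErrG a b c C K Cmv ε n Q 1 0 A' B₀ E T / (A' + 1)) ∧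
      ((rhoG a b c n : ℝ) / n * kappaG a b c Q E T * ∑ m ∈ Finset.Ioc A' B₀, (((X / m : ℕ) : ℝ)) / m -
            ((X / (A' + 1) + 1 : ℕ) : ℝ) * windowErrG a b c C K Cmv ε n Q 1 0 A' B₀ E T / (A' + 1) ≤
          vsumG a b c X ((Finset.Ioc A' B₀).filter (fun m : ℕ => m.Coprime Q)) n) := by
  obtain ⟨C, K, Cmv, hC0, hK1, hCmv0, hC⟩ := windowSum_inv_linearG h4 ha hc hirr hε
  refine ⟨C, K, Cmv, hC0, hK1, hCmv0, ?_⟩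
  intro X n Q A' B₀ E T hQ hnQ hA hAB hA'c hE hT hTEA
  have hQ0 : Q ≠ 0 := hQ.ne_zero
  have hn : 0 < n := Nat.pos_of_dvd_of_pos hnQ (Nat.pos_of_ne_zero hQ0)
  have hc0 : c ≠ 0 := by rintro rfl; exact (Int.not_even_iff_odd.2 hc) ⟨0, by simp⟩
  set Msf := (Finset.Ioc A' B₀).filter (fun m : ℕ => m.Coprime Q) with hMsf
  set e : ℝ := (rhoG a b c n : ℝ) / n with he
  set κ : ℝ := kappaG a b c Q E T with hκ
  set Err : ℝ := windowErrG a b c C K Cmv ε n Q 1 0 A' B₀ E T with hErr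
  set Lmax : ℕ := X / (A' + 1) with hLmax
  have hMs_pos : ∀ m ∈ Msf, 0 < m := by
    intro m hm; rw [hMsf, Finset.mem_filter, Finset.mem_Ioc] at hm; omega
  have hMs_ndvd : ∀ m ∈ Msf, ¬ (m : ℤ) ∣ c := by
    intro m hm h
    rw [hMsf, Finset.mem_filter, Finset.mem_Ioc] at hm
    have h1 : m ∣ c.natAbs := Int.natCast_dvd.1 h
    have h2 : m ≤ c.natAbs := Nat.le_of_dvd (Int.natAbs_pos.2 hc0) h1
    omega
  -- Step 1: `V = ∑_m |𝒜_{mn}|/m`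
  have hV : vsumG a b c X Msf n = ∑ m ∈ Msf, (congrCountG a b c (X : ℝ) (m * n) : ℝ) / m := by
    unfold vsumG
    refine Finset.sum_congr rfl fun m hm => ?_
    have hm0 := hMs_pos m hm
    rw [hMsf, Finset.mem_filter] at hm
    have hmn : m.Coprime n := Nat.Coprime.coprime_dvd_right hnQ hm.2
    rw [congrCountG_mul_eq_sum_xcountG (X : ℝ) hm0 hmn, Nat.floor_natCast, Nat.cast_sum,
      Finset.sum_div]
  -- the per-layer estimate
  have hlayer : ∀ (l t : ℕ), t ≤ B₀ →
      |∑ m ∈ (Finset.Ioc A' t).filter (fun m : ℕ => m.Coprime Q), (wcountG a b c m n (l % n) : ℝ) / m -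
          e * κ * ∑ m ∈ Finset.Ioc A' t, (1 : ℝ) / m| ≤ Err / (A' + 1) := by
    intro l t htB
    rcases le_or_gt A' t with hAt | hAt
    · rw [sum_wcountG_div_eq_familyG]
      have h := (hC n Q 1 0 0 A' t (l % n) E T hQ hnQ (one_dvd n) (Nat.coprime_one_left _)
        (Nat.coprime_one_right 0) (by simp) hA hAt (Nat.mod_lt l hn) hE hT hTEA).2
      rw [Nat.div_one, Nat.totient_one, Nat.cast_one, div_one] at h
      have hmono : windowErrG a b c C K Cmv ε n Q 1 0 A' t E T ≤ Err := windowErrG_mono hC0 hK1 hCmv0 hε.le htB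
      have hA1 : (0 : ℝ) < A' + 1 := by positivity
      calc _ ≤ windowErrG a b c C K Cmv ε n Q 1 0 A' t E T / (A' + 1) := by
            convert h using 3; rw [he, hκ]; ring
        _ ≤ Err / (A' + 1) := div_le_div_of_nonneg_right hmono hA1.le
    · have h1 : Finset.Ioc A' t = ∅ := Finset.Ioc_eq_empty (by omega)
      rw [h1, Finset.filter_empty, Finset.sum_empty, Finset.sum_empty, mul_zero, sub_zero, abs_zero]
      have : 0 ≤ Err := by
        rw [hErr]
        have h := (hC n Q 1 0 0 A' B₀ (l % n) E T hQ hnQ (one_dvd n) (Nat.coprime_one_left _)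
          (Nat.coprime_one_right 0) (by simp) hA hAB (Nat.mod_lt l hn) hE hT hTEA).1
        exact (abs_nonneg _).trans h
      positivity
  have hL : ∀ m ∈ Msf, X / m + 1 ≤ Lmax + 1 := by
    intro m hm
    rw [hMsf, Finset.mem_filter, Finset.mem_Ioc] at hm
    exact Nat.succ_le_succ (Nat.div_le_div_left (by omega) (by omega))
  have hL' : ∀ m ∈ Msf, X / m ≤ Lmax + 1 := fun m hm => (Nat.le_succ _).trans (hL m hm)
  have hLall : ∀ m ∈ Finset.Ioc A' B₀, X / m + 1 ≤ Lmax + 1 := by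
    intro m hm
    rw [Finset.mem_Ioc] at hm
    exact Nat.succ_le_succ (Nat.div_le_div_left (by omega) (by omega))
  have hLall' : ∀ m ∈ Finset.Ioc A' B₀, X / m ≤ Lmax + 1 := fun m hm => (Nat.le_succ _).trans (hLall m hm)
  -- the filtered `m`-ranges of the layers
  have hfilP : ∀ l, Msf.filter (fun m => l < X / m + 1) =
      (Finset.Ioc A' (bPlus B₀ X l)).filter (fun m : ℕ => m.Coprime Q) := by
    intro l
    rw [hMsf, Finset.filter_filter, ← filter_Ioc_lt_div_add_one A' B₀ X l, Finset.filter_filter]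
    exact Finset.filter_congr fun m _ => and_comm
  have hfilM : ∀ l, Msf.filter (fun m => l < X / m) =
      (Finset.Ioc A' (bMinus B₀ X l)).filter (fun m : ℕ => m.Coprime Q) := by
    intro l
    rw [hMsf, Finset.filter_filter, ← filter_Ioc_lt_div A' B₀ X l, Finset.filter_filter]
    exact Finset.filter_congr fun m _ => and_comm
  constructor
  · -- Upper bound
    have hVle : vsumG a b c X Msf n ≤ ∑ m ∈ Msf, ∑ l ∈ Finset.range (X / m + 1), (wcountG a b c m n (l % n) : ℝ) / m := by
      rw [hV]
      refine Finset.sum_le_sum fun m hm => ?_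
      have hm0 := hMs_pos m hm
      rw [← Finset.sum_div]
      refine div_le_div_of_nonneg_right ?_ (Nat.cast_nonneg _)
      have := congrCountG_le_sum_wcountG (a := a) (b := b) (c := c) (X : ℝ) (m := m) hm0 hn
      rw [Nat.floor_natCast] at this
      exact_mod_cast this
    refine hVle.trans ?_
    rw [sum_sum_range_comm Msf (fun m => X / m + 1) hL]
    have hmain : ∑ m ∈ Finset.Ioc A' B₀, (((X / m + 1 : ℕ) : ℝ)) / m =
        ∑ l ∈ Finset.range (Lmax + 1), ∑ m ∈ Finset.Ioc A' (bPlus B₀ X l), (1 : ℝ) / m := by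
      have : ∀ m ∈ Finset.Ioc A' B₀, (((X / m + 1 : ℕ) : ℝ)) / m =
          ∑ l ∈ Finset.range (X / m + 1), (1 : ℝ) / m := by
        intro m _; rw [Finset.sum_const, Finset.card_range, nsmul_eq_mul]; ring
      rw [Finset.sum_congr rfl this, sum_sum_range_comm (Finset.Ioc A' B₀) (fun m => X / m + 1) hLall]
      refine Finset.sum_congr rfl fun l _ => ?_
      rw [filter_Ioc_lt_div_add_one]
    rw [hmain, Finset.mul_sum]
    have hstep : ∀ l ∈ Finset.range (Lmax + 1),
        ∑ m ∈ Msf.filter (fun m => l < X / m + 1), (wcountG a b c m n (l % n) : ℝ) / m ≤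
          e * κ * ∑ m ∈ Finset.Ioc A' (bPlus B₀ X l), (1 : ℝ) / m + Err / (A' + 1) := by
      intro l _
      rw [hfilP l]
      have h := hlayer l (bPlus B₀ X l) (bPlus_le B₀ X l)
      have := (abs_le.mp h).2
      linarith
    calc ∑ l ∈ Finset.range (Lmax + 1), ∑ m ∈ Msf.filter (fun m => l < X / m + 1),
          (wcountG a b c m n (l % n) : ℝ) / m
        ≤ ∑ l ∈ Finset.range (Lmax + 1),
          (e * κ * ∑ m ∈ Finset.Ioc A' (bPlus B₀ X l), (1 : ℝ) / m + Err / (A' + 1)) :=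
          Finset.sum_le_sum hstep
      _ = _ := by
          rw [Finset.sum_add_distrib, Finset.sum_const, Finset.card_range, nsmul_eq_mul]
          push_cast
          ring
  · -- Lower bound
    have hVge : ∑ m ∈ Msf, ∑ l ∈ Finset.range (X / m), (wcountG a b c m n (l % n) : ℝ) / m ≤ vsumG a b c X Msf n := by
      rw [hV]
      refine Finset.sum_le_sum fun m hm => ?_
      have hm0 := hMs_pos m hm
      rw [← Finset.sum_div]
      refine div_le_div_of_nonneg_right ?_ (Nat.cast_nonneg _)
      have := sum_wcountG_le_congrCountG_of_not_dvd (a := a) (b := b) (X : ℝ) (m := m) hm0 hn (hMs_ndvd m hm)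
      rw [Nat.floor_natCast] at this
      exact_mod_cast this
    refine le_trans ?_ hVge
    rw [sum_sum_range_comm Msf (fun m => X / m) hL']
    have hmain : ∑ m ∈ Finset.Ioc A' B₀, (((X / m : ℕ) : ℝ)) / m =
        ∑ l ∈ Finset.range (Lmax + 1), ∑ m ∈ Finset.Ioc A' (bMinus B₀ X l), (1 : ℝ) / m := by
      have : ∀ m ∈ Finset.Ioc A' B₀, (((X / m : ℕ) : ℝ)) / m =
          ∑ l ∈ Finset.range (X / m), (1 : ℝ) / m := by
        intro m _; rw [Finset.sum_const, Finset.card_range, nsmul_eq_mul]; ring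
      rw [Finset.sum_congr rfl this, sum_sum_range_comm (Finset.Ioc A' B₀) (fun m => X / m) hLall']
      refine Finset.sum_congr rfl fun l _ => ?_
      rw [filter_Ioc_lt_div]
    rw [hmain, Finset.mul_sum]
    have hstep : ∀ l ∈ Finset.range (Lmax + 1),
        e * κ * ∑ m ∈ Finset.Ioc A' (bMinus B₀ X l), (1 : ℝ) / m - Err / (A' + 1) ≤
          ∑ m ∈ Msf.filter (fun m => l < X / m), (wcountG a b c m n (l % n) : ℝ) / m := by
      intro l _
      rw [hfilM l]
      have h := hlayer l (bMinus B₀ X l) (bMinus_le B₀ X l)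
      have := (abs_le.mp h).1
      linarith
    calc ∑ l ∈ Finset.range (Lmax + 1), e * κ * ∑ m ∈ Finset.Ioc A' (bMinus B₀ X l), (1 : ℝ) / m -
          ((Lmax + 1 : ℕ) : ℝ) * Err / (A' + 1)
        = ∑ l ∈ Finset.range (Lmax + 1),
          (e * κ * ∑ m ∈ Finset.Ioc A' (bMinus B₀ X l), (1 : ℝ) / m - Err / (A' + 1)) := by
          rw [Finset.sum_sub_distrib, Finset.sum_const, Finset.card_range, nsmul_eq_mul]
          push_cast
          ring
      _ ≤ _ := Finset.sum_le_sum hstep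


/-! ### Helpers for `W`: `ρ_G ≤ τ` on squarefree numbers, vanishing window counts, a `μ`-uniform error -/

/-- `ρ_G(p) ≤ 2` at every prime `p` (the reduction of `G` mod `p` is a nonzero polynomial of
degree `≤ 2` over `𝔽_p`, by primitivity). [folklore] -/
theorem rhoG_prime_le_two (ha : 0 < a) (hirr : Irreducible (quadPoly a b c)) {p : ℕ}
    (hp : p.Prime) : rhoG a b c p ≤ 2 := by
  classical
  haveI := Fact.mk hp
  rw [rhoG_eq_card_filter_zmod (d := p)]
  set f : Polynomial (ZMod p) := Polynomial.C (a : ZMod p) * Polynomial.X ^ 2 +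
    Polynomial.C (b : ZMod p) * Polynomial.X + Polynomial.C (c : ZMod p) with hf
  have hf0 : f ≠ 0 := by
    intro h0
    have h2 := congrArg (fun g : Polynomial (ZMod p) => g.coeff 2) h0
    have h1 := congrArg (fun g : Polynomial (ZMod p) => g.coeff 1) h0
    have h00 := congrArg (fun g : Polynomial (ZMod p) => g.coeff 0) h0
    simp only [hf, Polynomial.coeff_add, Polynomial.coeff_C_mul, Polynomial.coeff_X_pow,
      Polynomial.coeff_X, Polynomial.coeff_C, Polynomial.coeff_zero] at h2 h1 h00
    norm_num at h2 h1 h00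
    rw [ZMod.intCast_zmod_eq_zero_iff_dvd] at h2 h1 h00
    exact false_of_prime_dvd_coeffs ha.ne' hirr hp h2 h1 h00
  have hdeg : f.natDegree ≤ 2 := Polynomial.natDegree_quadratic_le
  have hsub : (Finset.univ.filter (fun x : ZMod p => (a : ZMod p) * x ^ 2 + b * x + c = 0)) ⊆
      f.roots.toFinset := by
    intro x hx
    rw [Finset.mem_filter] at hx
    rw [Multiset.mem_toFinset, Polynomial.mem_roots hf0, Polynomial.IsRoot.def, hf]
    simp only [Polynomial.eval_add, Polynomial.eval_mul, Polynomial.eval_C, Polynomial.eval_pow,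
      Polynomial.eval_X]
    exact hx.2
  calc (Finset.univ.filter (fun x : ZMod p => (a : ZMod p) * x ^ 2 + b * x + c = 0)).card
      ≤ f.roots.toFinset.card := Finset.card_le_card hsub
    _ ≤ Multiset.card f.roots := Multiset.toFinset_card_le _
    _ ≤ f.natDegree := Polynomial.card_roots' f
    _ ≤ 2 := hdeg

/-- `ρ_G(n) ≤ τ(n)` for squarefree `n` (`ρ_G` multiplicative, `ρ_G(p) ≤ 2`, `τ(n) = 2^{ω(n)}`).
[folklore] -/
theorem rhoG_le_card_divisors_of_squarefree (ha : 0 < a) (hirr : Irreducible (quadPoly a b c))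
    {n : ℕ} (hn : Squarefree n) : rhoG a b c n ≤ n.divisors.card := by
  have hmul : (rhoG a b c n : ℝ) = ∏ p ∈ n.primeFactors, (rhoG a b c p : ℝ) := by
    have h := (isMultiplicative_rhoGArith (a := a) (b := b) (c := c)).map_prod_of_prime n.primeFactors
      (fun p hp => Nat.prime_of_mem_primeFactors hp)
    rw [Nat.prod_primeFactors_of_squarefree hn] at h
    simpa only [rhoGArith_apply] using h
  have hle : (rhoG a b c n : ℝ) ≤ (2 : ℝ) ^ n.primeFactors.card := by
    rw [hmul, ← Finset.prod_const]
    refine Finset.prod_le_prod (fun _ _ => Nat.cast_nonneg _) fun p hp => ?_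
    exact_mod_cast rhoG_prime_le_two ha hirr (Nat.prime_of_mem_primeFactors hp)
  have hτ : n.divisors.card = 2 ^ n.primeFactors.card :=
    Literature.NumberTheory.Sieve.card_divisors_of_squarefree hn
  have : (rhoG a b c n : ℝ) ≤ (n.divisors.card : ℝ) := by rw [hτ]; push_cast; exact hle
  exact_mod_cast this

/-- A window count vanishes unless `μ` is prime to `d` … [folklore] -/
theorem windowCountG_eq_zero_of_not_coprime {q Q d μ ω A t cc : ℕ} (hdQ : d ∣ Q)
    (h : ¬ μ.Coprime d) : windowCountG a b c q Q d μ ω A t cc = 0 := by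
  unfold windowCountG
  rw [Finset.card_eq_zero, Finset.filter_eq_empty_iff]
  intro p hp _
  rw [mem_lemma4FamilyG] at hp
  apply h
  have h1 : p.1.Coprime d := Nat.Coprime.coprime_dvd_right hdQ hp.2.1
  rw [Nat.Coprime, ← Nat.ModEq.gcd_eq hp.2.2.1]
  exact h1

/-- … and unless `ω` is a root of `G` modulo `d`. [folklore] -/
theorem windowCountG_eq_zero_of_not_root {q Q d μ ω A t cc : ℕ} (hdq : d ∣ q)
    (h : ¬ (d : ℤ) ∣ quadVal a b c ω) : windowCountG a b c q Q d μ ω A t cc = 0 := by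
  unfold windowCountG
  rw [Finset.card_eq_zero, Finset.filter_eq_empty_iff]
  intro p hp _
  rw [mem_lemma4FamilyG, mem_rootsG] at hp
  apply h
  have h1 : (d : ℤ) ∣ quadVal a b c p.2 :=
    (Int.natCast_dvd_natCast.2 (hdq.trans (dvd_mul_left q p.1))).trans (by exact_mod_cast hp.2.2.2.1.2)
  exact dvd_quadVal_of_modEq (Int.natCast_modEq_iff.2 hp.2.2.2.2) h1

/-- `Σ₀(t; Q, d, μ) ≤ Σ₀(t; Q, 1, 0)` (a sub-sum). [folklore] -/
theorem rhoSumAPG_le_rhoSumAPG_one (t Q d μ : ℕ) : rhoSumAPG a b c t Q d μ ≤ rhoSumAPG a b c t Q 1 0 := by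
  unfold rhoSumAPG
  refine Finset.sum_le_sum_of_subset_of_nonneg ?_ fun _ _ _ => Nat.zero_le _
  intro m hm
  rw [Finset.mem_filter] at hm ⊢
  exact ⟨hm.1, hm.2.1, Nat.modEq_one⟩

/-- The `μ`- and `t`-uniform error for the `W`-windows of the pair `(q, d)`, for `𝒜_G`:
`4ρ_G(q)Σ₀(B₀)/A'^{1/4} + C d K^{ω(q)} (1+log 16A')² S₀^{1/2+ε} S₀ + (2/q)ρ_G(q) · 2·mvErrG(q, B₀)`,
`S₀ = ⌊√(B₀ q)⌋`. [cite: IwaniecInventiones1978, §4 p. 184] -/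
def wErrG (a b c : ℤ) (C K Cmv ε : ℝ) (q d A' B₀ E T : ℕ) : ℝ :=
  4 * (rhoG a b c q : ℝ) * (rhoSumAPG a b c B₀ q 1 0 : ℝ) / (A' : ℝ) ^ (1 / 4 : ℝ) +
    C * d * K ^ q.primeFactors.card * (1 + Real.log (16 * A')) ^ 2 *
      ((Nat.sqrt (B₀ * q) : ℝ) ^ (1 / 2 + ε) * Nat.sqrt (B₀ * q)) +
    2 / q * (rhoG a b c q : ℝ) * (2 * mvErrG a b c Cmv q B₀ E T)

/-- `windowErrG` for an admissible class (`d₂ ∣ d`, `d₂ ∣ q`, `ρ_G(d₂) ≥ 1`, `t ≤ B₀`) is at most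
`wErrG`. [folklore] -/
theorem windowErrG_le_wErrG {C K Cmv ε : ℝ} (hC : 0 ≤ C) (hK : 1 ≤ K) (hCmv : 0 ≤ Cmv) (hε : 0 ≤ ε)
    {q d d₂ μ A' t B₀ E T : ℕ} (hq : Squarefree q) (hd : 0 < d) (hd₂d : d₂ ∣ d) (hd₂q : d₂ ∣ q)
    (hρ : 1 ≤ rhoG a b c d₂) (ht : t ≤ B₀) :
    windowErrG a b c C K Cmv ε q q d₂ μ A' t E T ≤ wErrG a b c C K Cmv ε q d A' B₀ E T := by
  have hρq : (rhoG a b c (q / d₂) : ℝ) ≤ rhoG a b c q := by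
    have h := rhoG_div_mul_rhoG (a := a) (b := b) (c := c) hq hd₂q
    have : rhoG a b c (q / d₂) * 1 ≤ rhoG a b c (q / d₂) * rhoG a b c d₂ := Nat.mul_le_mul_left _ hρ
    rw [mul_one, h] at this
    exact_mod_cast this
  have hSig : (rhoSumAPG a b c t q d₂ μ : ℝ) ≤ rhoSumAPG a b c B₀ q 1 0 := by
    exact_mod_cast (rhoSumAPG_le_rhoSumAPG_one t q d₂ μ).trans (rhoSumAPG_mono ht q 1 0)
  have hdd : (d₂ : ℝ) ≤ d := by exact_mod_cast Nat.le_of_dvd hd hd₂d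
  have hS : (Nat.sqrt (t * q) : ℝ) ≤ Nat.sqrt (B₀ * q) := by
    exact_mod_cast Nat.sqrt_le_sqrt (Nat.mul_le_mul_right q ht)
  have hS0 : (0 : ℝ) ≤ Nat.sqrt (t * q) := Nat.cast_nonneg _
  have hS' : (Nat.sqrt (t * q) : ℝ) ^ (1 / 2 + ε) ≤ (Nat.sqrt (B₀ * q) : ℝ) ^ (1 / 2 + ε) :=
    Real.rpow_le_rpow hS0 hS (by linarith)
  have hmv : mvErrG a b c Cmv q t E T ≤ mvErrG a b c Cmv q B₀ E T := mvErrG_mono hCmv q E T ht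
  have hmv0 : 0 ≤ mvErrG a b c Cmv q t E T := mvErrG_nonneg hCmv q t E T
  have hA : 0 ≤ (A' : ℝ) ^ (1 / 4 : ℝ) := Real.rpow_nonneg (Nat.cast_nonneg _) _
  have hKp : 0 ≤ K ^ q.primeFactors.card := pow_nonneg (by linarith) _
  have hρ0 : (0 : ℝ) ≤ rhoG a b c (q / d₂) := Nat.cast_nonneg _
  have hSig0 : (0 : ℝ) ≤ rhoSumAPG a b c t q d₂ μ := Nat.cast_nonneg _
  have hL : (0 : ℝ) ≤ (1 + Real.log (16 * A')) ^ 2 := sq_nonneg _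
  have h1 : 4 * (rhoG a b c (q / d₂) : ℝ) * (rhoSumAPG a b c t q d₂ μ : ℝ) / (A' : ℝ) ^ (1 / 4 : ℝ) ≤
      4 * (rhoG a b c q : ℝ) * (rhoSumAPG a b c B₀ q 1 0 : ℝ) / (A' : ℝ) ^ (1 / 4 : ℝ) := by
    apply div_le_div_of_nonneg_right _ hA
    exact mul_le_mul (mul_le_mul_of_nonneg_left hρq (by norm_num)) hSig hSig0 (by positivity)
  have h2 : C * d₂ * K ^ q.primeFactors.card * (1 + Real.log (16 * A')) ^ 2 *
        ((Nat.sqrt (t * q) : ℝ) ^ (1 / 2 + ε) * Nat.sqrt (t * q)) ≤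
      C * d * K ^ q.primeFactors.card * (1 + Real.log (16 * A')) ^ 2 *
        ((Nat.sqrt (B₀ * q) : ℝ) ^ (1 / 2 + ε) * Nat.sqrt (B₀ * q)) := by
    have hP0 : (0 : ℝ) ≤ (Nat.sqrt (t * q) : ℝ) ^ (1 / 2 + ε) * Nat.sqrt (t * q) :=
      mul_nonneg (Real.rpow_nonneg hS0 _) hS0
    have hP : (Nat.sqrt (t * q) : ℝ) ^ (1 / 2 + ε) * Nat.sqrt (t * q) ≤
        (Nat.sqrt (B₀ * q) : ℝ) ^ (1 / 2 + ε) * Nat.sqrt (B₀ * q) :=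
      mul_le_mul hS' hS hS0 (Real.rpow_nonneg (Nat.cast_nonneg _) _)
    have hK' : C * d₂ * K ^ q.primeFactors.card * (1 + Real.log (16 * A')) ^ 2 ≤
        C * d * K ^ q.primeFactors.card * (1 + Real.log (16 * A')) ^ 2 :=
      mul_le_mul_of_nonneg_right (mul_le_mul_of_nonneg_right
        (mul_le_mul_of_nonneg_left hdd hC) hKp) hL
    have hK0 : 0 ≤ C * d * K ^ q.primeFactors.card * (1 + Real.log (16 * A')) ^ 2 := by positivity
    exact mul_le_mul hK' hP hP0 hK0
  have h3 : 2 / q * (rhoG a b c (q / d₂) : ℝ) * (2 * mvErrG a b c Cmv q t E T) ≤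
      2 / q * (rhoG a b c q : ℝ) * (2 * mvErrG a b c Cmv q B₀ E T) := by
    have hq2 : (0 : ℝ) ≤ 2 / q := by positivity
    exact mul_le_mul (mul_le_mul_of_nonneg_left hρq hq2) (by linarith) (by positivity)
      (mul_nonneg hq2 (Nat.cast_nonneg _))
  unfold windowErrG wErrG
  exact add_le_add (add_le_add h1 h2) h3

/-- `wErrG ≥ 0`. [folklore] -/
theorem wErrG_nonneg {C K Cmv : ℝ} (hC : 0 ≤ C) (hK : 1 ≤ K) (hCmv : 0 ≤ Cmv) (ε : ℝ) (q d A' B₀ E T : ℕ) :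
    0 ≤ wErrG a b c C K Cmv ε q d A' B₀ E T := by
  unfold wErrG
  have hKp : 0 ≤ K ^ q.primeFactors.card := pow_nonneg (by linarith) _
  have := mvErrG_nonneg (a := a) (b := b) (c := c) hCmv q B₀ E T
  positivity

/-! ### The per-`(l₁, l₂)` linear model for the `W`-counts -/

/-- `g_G(l₁, l₂) = [(d₂, 2a) = 1, (d₂, Δ) = 1]/φ(d₂)`, `d₂ = d/(d, |l₁ − l₂|)`: the density of the
`W`-count of the pair `(l₁, l₂)` relative to `ρ_G(q)κ_G/q` (Lemke Oliver's `ψ`-factor, p. 249).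
[cite: IwaniecInventiones1978, §4 p. 183] -/
def gfunG (a b c : ℤ) (d l₁ l₂ : ℕ) : ℝ :=
  if (2 * a.natAbs).Coprime (dtwo d l₁ l₂) ∧ (dtwo d l₁ l₂).Coprime (b ^ 2 - 4 * a * c).natAbs then
    1 / (Nat.totient (dtwo d l₁ l₂) : ℝ) else 0

/-- `g_G ≥ 0`. [folklore] -/
theorem gfunG_nonneg (d l₁ l₂ : ℕ) : 0 ≤ gfunG a b c d l₁ l₂ := by
  unfold gfunG; split_ifs <;> positivity

/-- **The `W`-count of a pair `(l₁, l₂)` over `A' < m ≤ t` against its linear model**, for `𝒜_G`: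
with `q = [n₁, n₂]`, `d = (n₁, n₂)`,
`|∑_{A'<m≤t, (m,n₁n₂)=1} wpairG(m; l₁, l₂) − (ρ_G(q)/q) κ_G g_G(l₁, l₂) (t − A')| ≤ τ(d) · wErrG`
(sum over the `ρ_G(d₂) ≤ τ(d)` admissible classes `μ mod d₂` of the window counts of Lemma 4,
`ρ_G(q/d₂)ρ_G(d₂) = ρ_G(q)`; no admissible class unless `(d₂, 2aΔ) = 1`).
[cite: IwaniecInventiones1978, §4 pp. 183–184] -/
theorem sum_wpairG_linear (h4 : rootExpSumBoundG a b c) (ha : 0 < a) (hc : Odd c)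
    (hirr : Irreducible (quadPoly a b c)) {ε : ℝ} (hε : 0 < ε) :
    ∃ C K Cmv : ℝ, 0 ≤ C ∧ 1 ≤ K ∧ 0 ≤ Cmv ∧ ∀ (n₁ n₂ A' B₀ t E T l₁ l₂ : ℕ), Squarefree n₁ → Squarefree n₂ → 2 ≤ A' →
      t ≤ B₀ → 1 ≤ E → 1 ≤ T → T * E ≤ A' →
      |∑ m ∈ (Finset.Ioc A' t).filter (fun m : ℕ => n₁.Coprime m ∧ n₂.Coprime m),
          (wpairG a b c m n₁ n₂ l₁ l₂ : ℝ) -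
        (rhoG a b c (Nat.lcm n₁ n₂) : ℝ) / Nat.lcm n₁ n₂ * kappaG a b c (Nat.lcm n₁ n₂) E T *
          gfunG a b c (Nat.gcd n₁ n₂) l₁ l₂ * (((t - A' : ℕ) : ℝ))| ≤
      ((Nat.gcd n₁ n₂).divisors.card : ℝ) * wErrG a b c C K Cmv ε (Nat.lcm n₁ n₂) (Nat.gcd n₁ n₂) A' B₀ E T := by
  obtain ⟨C, K, Cmv, hC0, hK1, hCmv0, hC⟩ := windowSum_inv_linearG h4 ha hc hirr hε
  refine ⟨C, K, Cmv, hC0, hK1, hCmv0, ?_⟩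
  intro n₁ n₂ A' B₀ t E T l₁ l₂ hn₁ hn₂ hA htB hE hT hTEA
  have hn₁0 : n₁ ≠ 0 := hn₁.ne_zero
  have hRHS : 0 ≤ ((Nat.gcd n₁ n₂).divisors.card : ℝ) *
      wErrG a b c C K Cmv ε (Nat.lcm n₁ n₂) (Nat.gcd n₁ n₂) A' B₀ E T :=
    mul_nonneg (Nat.cast_nonneg _) (wErrG_nonneg hC0 hK1 hCmv0 ε _ _ A' B₀ E T)
  rcases lt_or_ge t A' with hAt | hAt
  · have h1 : Finset.Ioc A' t = ∅ := Finset.Ioc_eq_empty (by omega)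
    have h2 : t - A' = 0 := by omega
    rw [h1, Finset.filter_empty, Finset.sum_empty, h2]
    simpa using hRHS
  rw [sum_wpairG_eq_sum_windowCountG ha hc hirr hn₁ hn₂ l₁ l₂ A' t, Nat.cast_sub hAt]
  unfold gfunG
  set d := Nat.gcd n₁ n₂ with hd
  set q := Nat.lcm n₁ n₂ with hq
  set d₂ := dtwo d l₁ l₂ with hd₂
  set cc := crtc n₁ n₂ l₁ l₂ with hcc
  have hdpos : 0 < d := Nat.gcd_pos_of_pos_left _ (Nat.pos_of_ne_zero hn₁0)
  have hqsf : Squarefree q := by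
    obtain ⟨hcop, hlcm⟩ := coprime_div_gcd_of_squarefree hn₂ hn₁0
    rw [hq, hlcm, Nat.squarefree_mul_iff]
    exact ⟨hcop, hn₁, hn₂.squarefree_of_dvd (Nat.div_dvd_of_dvd (Nat.gcd_dvd_right _ _))⟩
  have hd₂d : d₂ ∣ d := dtwo_dvd d l₁ l₂
  have hdq : d ∣ q := (Nat.gcd_dvd_left n₁ n₂).trans (Nat.dvd_lcm_left n₁ n₂)
  have hd₂q : d₂ ∣ q := hd₂d.trans hdq
  have hd₂sf : Squarefree d₂ := (hn₁.squarefree_of_dvd (Nat.gcd_dvd_left _ _)).squarefree_of_dvd hd₂d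
  have hcq : cc < q := (crtc_spec hn₂ hn₁0 l₁ l₂).2.2
  by_cases hgood : (2 * a.natAbs).Coprime d₂
  swap
  · rw [if_pos hgood, if_neg (fun h => hgood h.1)]
    simpa using hRHS
  rw [if_neg (not_not_intro hgood)]
  set adm := (Finset.range d₂).filter (fun μ : ℕ =>
    μ.Coprime d₂ ∧ ((d₂ : ℕ) : ℤ) ∣ quadVal a b c (omegaOfG a b d₂ cc l₁ l₂ μ)) with hadm
  have hcard : adm.card = if d₂.Coprime (b ^ 2 - 4 * a * c).natAbs then rhoG a b c d₂ else 0 :=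
    card_admissibleG_eq hn₁ hn₂ l₁ l₂ hgood
  have hrestr : ∑ μ ∈ Finset.range d₂, (windowCountG a b c q q d₂ μ (omegaOfG a b d₂ cc l₁ l₂ μ) A' t cc : ℝ) =
      ∑ μ ∈ adm, (windowCountG a b c q q d₂ μ (omegaOfG a b d₂ cc l₁ l₂ μ) A' t cc : ℝ) := by
    rw [hadm, Finset.sum_filter]
    refine Finset.sum_congr rfl fun μ _ => ?_
    split_ifs with hμ
    · rfl
    · rw [not_and_or] at hμ
      rcases hμ with hμ | hμ
      · rw [windowCountG_eq_zero_of_not_coprime hd₂q hμ, Nat.cast_zero]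
      · rw [windowCountG_eq_zero_of_not_root hd₂q hμ, Nat.cast_zero]
  rw [hrestr]
  by_cases hΔ : d₂.Coprime (b ^ 2 - 4 * a * c).natAbs
  swap
  · -- no admissible class: both sides vanish
    rw [if_neg hΔ] at hcard
    rw [Finset.card_eq_zero.1 hcard, Finset.sum_empty, if_neg (fun h => hΔ h.2)]
    simpa using hRHS
  rw [if_pos hΔ] at hcard
  rw [if_pos ⟨hgood, hΔ⟩]
  have hd₂D : d₂.Coprime (badMod a b c) := by
    unfold badMod
    rw [Int.natAbs_mul, Int.natAbs_mul]
    have e : (2 : ℤ).natAbs * a.natAbs = 2 * a.natAbs := by rfl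
    rw [e]
    exact Nat.Coprime.mul_right hgood.symm hΔ
  set main : ℝ := 1 / q * (rhoG a b c (q / d₂) : ℝ) * (kappaG a b c q E T / Nat.totient d₂) * ((t : ℝ) - A')
    with hmain
  have hper : ∀ μ ∈ adm,
      |(windowCountG a b c q q d₂ μ (omegaOfG a b d₂ cc l₁ l₂ μ) A' t cc : ℝ) - main| ≤ wErrG a b c C K Cmv ε q d A' B₀ E T := by
    intro μ hμ
    have hμ' := hμ
    rw [hadm, Finset.mem_filter] at hμ'
    have h := (hC q q d₂ μ (omegaOfG a b d₂ cc l₁ l₂ μ) A' t cc E T hqsf dvd_rfl hd₂q hd₂D hμ'.2.1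
      hμ'.2.2 hA hAt hcq hE hT hTEA).1
    refine h.trans (windowErrG_le_wErrG hC0 hK1 hCmv0 hε.le hqsf hdpos hd₂d hd₂q ?_ htB)
    rw [← hcard]
    exact Finset.card_pos.mpr ⟨μ, hμ⟩
  have hsum : |∑ μ ∈ adm, ((windowCountG a b c q q d₂ μ (omegaOfG a b d₂ cc l₁ l₂ μ) A' t cc : ℝ) - main)| ≤
      adm.card * wErrG a b c C K Cmv ε q d A' B₀ E T := by
    calc _ ≤ ∑ μ ∈ adm, |(windowCountG a b c q q d₂ μ (omegaOfG a b d₂ cc l₁ l₂ μ) A' t cc : ℝ) - main| :=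
          Finset.abs_sum_le_sum_abs _ _
      _ ≤ ∑ μ ∈ adm, wErrG a b c C K Cmv ε q d A' B₀ E T := Finset.sum_le_sum hper
      _ = _ := by rw [Finset.sum_const, nsmul_eq_mul]
  have hmain_eq : (adm.card : ℝ) * main =
      (rhoG a b c q : ℝ) / q * kappaG a b c q E T * (1 / (Nat.totient d₂ : ℝ)) * ((t : ℝ) - A') := by
    rw [hcard, hmain]
    have hρ : (rhoG a b c (q / d₂) : ℝ) * rhoG a b c d₂ = rhoG a b c q := by
      exact_mod_cast rhoG_div_mul_rhoG hqsf hd₂q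
    rw [← hρ]; ring
  have hcardle : (adm.card : ℝ) ≤ d.divisors.card := by
    rw [hcard]
    exact_mod_cast (rhoG_le_card_divisors_of_squarefree ha hirr hd₂sf).trans
      (Finset.card_le_card (Nat.divisors_subset_of_dvd hdpos.ne' hd₂d))
  calc |∑ μ ∈ adm, (windowCountG a b c q q d₂ μ (omegaOfG a b d₂ cc l₁ l₂ μ) A' t cc : ℝ) -
          (rhoG a b c q : ℝ) / q * kappaG a b c q E T * (1 / (Nat.totient d₂ : ℝ)) * ((t : ℝ) - A')|
      = |∑ μ ∈ adm, ((windowCountG a b c q q d₂ μ (omegaOfG a b d₂ cc l₁ l₂ μ) A' t cc : ℝ) - main)| := by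
        rw [Finset.sum_sub_distrib, Finset.sum_const, nsmul_eq_mul, hmain_eq]
    _ ≤ adm.card * wErrG a b c C K Cmv ε q d A' B₀ E T := hsum
    _ ≤ d.divisors.card * wErrG a b c C K Cmv ε q d A' B₀ E T :=
        mul_le_mul_of_nonneg_right hcardle (wErrG_nonneg hC0 hK1 hCmv0 ε q d A' B₀ E T)

/-! ### The evaluation of `W` -/

/-- **`W` against its main term, upper and lower bounds** (p. 183–184, in the `m`-first form), for
`𝒜_G`: with `Msf = {A' < m ≤ B₀ : (m, n₁) = (m, n₂) = 1}`, `q = [n₁,n₂]`, `d = (n₁,n₂)`,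
`κ = kappaG q E T`, `L = ⌊X/(A'+1)⌋`, and `A' ≥ |c|`:
`W ≤ (ρ_G(q)/q) κ ∑_{A'<m≤B₀} ∑_{l₁,l₂ ≤ ⌊X/m⌋} g_G(l₁,l₂) + (L+1)² τ(d) wErrG` and
`(ρ_G(q)/q) κ ∑_{A'<m≤B₀} ∑_{l₁,l₂ < ⌊X/m⌋} g_G(l₁,l₂) − (L+1)² τ(d) wErrG ≤ W`.
[cite: IwaniecInventiones1978, §4 pp. 183–184] -/
theorem wsum_boundsG (h4 : rootExpSumBoundG a b c) (ha : 0 < a) (hc : Odd c)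
    (hirr : Irreducible (quadPoly a b c)) {ε : ℝ} (hε : 0 < ε) :
    ∃ C K Cmv : ℝ, 0 ≤ C ∧ 1 ≤ K ∧ 0 ≤ Cmv ∧ ∀ (X n₁ n₂ A' B₀ E T : ℕ), Squarefree n₁ → Squarefree n₂ → 2 ≤ A' →
      c.natAbs ≤ A' → 1 ≤ E → 1 ≤ T → T * E ≤ A' →
      ((wsumG a b c X ((Finset.Ioc A' B₀).filter (fun m : ℕ => n₁.Coprime m ∧ n₂.Coprime m)) n₁ n₂ : ℝ) ≤
          (rhoG a b c (Nat.lcm n₁ n₂) : ℝ) / Nat.lcm n₁ n₂ * kappaG a b c (Nat.lcm n₁ n₂) E T *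
              ∑ m ∈ Finset.Ioc A' B₀, ∑ l₁ ∈ Finset.range (X / m + 1),
                ∑ l₂ ∈ Finset.range (X / m + 1), gfunG a b c (Nat.gcd n₁ n₂) l₁ l₂ +
            ((X / (A' + 1) + 1 : ℕ) : ℝ) ^ 2 * (((Nat.gcd n₁ n₂).divisors.card : ℝ) *
              wErrG a b c C K Cmv ε (Nat.lcm n₁ n₂) (Nat.gcd n₁ n₂) A' B₀ E T)) ∧
      ((rhoG a b c (Nat.lcm n₁ n₂) : ℝ) / Nat.lcm n₁ n₂ * kappaG a b c (Nat.lcm n₁ n₂) E T *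
              ∑ m ∈ Finset.Ioc A' B₀, ∑ l₁ ∈ Finset.range (X / m),
                ∑ l₂ ∈ Finset.range (X / m), gfunG a b c (Nat.gcd n₁ n₂) l₁ l₂ -
            ((X / (A' + 1) + 1 : ℕ) : ℝ) ^ 2 * (((Nat.gcd n₁ n₂).divisors.card : ℝ) *
              wErrG a b c C K Cmv ε (Nat.lcm n₁ n₂) (Nat.gcd n₁ n₂) A' B₀ E T) ≤
          (wsumG a b c X ((Finset.Ioc A' B₀).filter (fun m : ℕ => n₁.Coprime m ∧ n₂.Coprime m)) n₁ n₂ : ℝ)) := by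
  obtain ⟨C, K, Cmv, hC0, hK1, hCmv0, hC⟩ := sum_wpairG_linear h4 ha hc hirr hε
  refine ⟨C, K, Cmv, hC0, hK1, hCmv0, ?_⟩
  intro X n₁ n₂ A' B₀ E T hn₁ hn₂ hA hA'c hE hT hTEA
  have hc0 : c ≠ 0 := by rintro rfl; exact (Int.not_even_iff_odd.2 hc) ⟨0, by simp⟩
  set Msf := (Finset.Ioc A' B₀).filter (fun m : ℕ => n₁.Coprime m ∧ n₂.Coprime m) with hMsf
  set eκ : ℝ := (rhoG a b c (Nat.lcm n₁ n₂) : ℝ) / Nat.lcm n₁ n₂ * kappaG a b c (Nat.lcm n₁ n₂) E T with heκ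
  set Err : ℝ := ((Nat.gcd n₁ n₂).divisors.card : ℝ) *
    wErrG a b c C K Cmv ε (Nat.lcm n₁ n₂) (Nat.gcd n₁ n₂) A' B₀ E T with hErr
  set Lmax : ℕ := X / (A' + 1) with hLmax
  have hMs_ndvd : ∀ m ∈ Msf, ¬ (m : ℤ) ∣ c := by
    intro m hm h
    rw [hMsf, Finset.mem_filter, Finset.mem_Ioc] at hm
    have h1 : m ∣ c.natAbs := Int.natCast_dvd.1 h
    have h2 : m ≤ c.natAbs := Nat.le_of_dvd (Int.natAbs_pos.2 hc0) h1
    omega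
  -- the per-pair estimate
  have hlayer : ∀ l₁ l₂ t, t ≤ B₀ →
      |∑ m ∈ (Finset.Ioc A' t).filter (fun m : ℕ => n₁.Coprime m ∧ n₂.Coprime m),
          (wpairG a b c m n₁ n₂ l₁ l₂ : ℝ) - eκ * gfunG a b c (Nat.gcd n₁ n₂) l₁ l₂ * (((t - A' : ℕ) : ℝ))| ≤ Err := by
    intro l₁ l₂ t ht
    rw [heκ, hErr]
    exact hC n₁ n₂ A' B₀ t E T l₁ l₂ hn₁ hn₂ hA ht hE hT hTEA
  have hL : ∀ m ∈ Msf, X / m + 1 ≤ Lmax + 1 := by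
    intro m hm
    rw [hMsf, Finset.mem_filter, Finset.mem_Ioc] at hm
    exact Nat.succ_le_succ (Nat.div_le_div_left (by omega) (by omega))
  have hL' : ∀ m ∈ Msf, X / m ≤ Lmax + 1 := fun m hm => (Nat.le_succ _).trans (hL m hm)
  have hLall : ∀ m ∈ Finset.Ioc A' B₀, X / m + 1 ≤ Lmax + 1 := by
    intro m hm
    rw [Finset.mem_Ioc] at hm
    exact Nat.succ_le_succ (Nat.div_le_div_left (by omega) (by omega))
  have hLall' : ∀ m ∈ Finset.Ioc A' B₀, X / m ≤ Lmax + 1 :=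
    fun m hm => (Nat.le_succ _).trans (hLall m hm)
  -- the filtered `m`-ranges of the layers
  have hIocP : ∀ l₁ l₂, (Finset.Ioc A' B₀).filter (fun m => l₁ < X / m + 1 ∧ l₂ < X / m + 1) =
      Finset.Ioc A' (bPlus (bPlus B₀ X l₁) X l₂) := by
    intro l₁ l₂
    rw [← filter_Ioc_lt_div_add_one, ← filter_Ioc_lt_div_add_one, Finset.filter_filter]
  have hIocM : ∀ l₁ l₂, (Finset.Ioc A' B₀).filter (fun m => l₁ < X / m ∧ l₂ < X / m) =
      Finset.Ioc A' (bMinus (bMinus B₀ X l₁) X l₂) := by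
    intro l₁ l₂
    rw [← filter_Ioc_lt_div, ← filter_Ioc_lt_div, Finset.filter_filter]
  have hfilP : ∀ l₁ l₂, Msf.filter (fun m => l₁ < X / m + 1 ∧ l₂ < X / m + 1) =
      (Finset.Ioc A' (bPlus (bPlus B₀ X l₁) X l₂)).filter
        (fun m : ℕ => n₁.Coprime m ∧ n₂.Coprime m) := by
    intro l₁ l₂
    rw [← hIocP, hMsf, Finset.filter_filter, Finset.filter_filter]
    exact Finset.filter_congr fun m _ => by tauto
  have hfilM : ∀ l₁ l₂, Msf.filter (fun m => l₁ < X / m ∧ l₂ < X / m) =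
      (Finset.Ioc A' (bMinus (bMinus B₀ X l₁) X l₂)).filter
        (fun m : ℕ => n₁.Coprime m ∧ n₂.Coprime m) := by
    intro l₁ l₂
    rw [← hIocM, hMsf, Finset.filter_filter, Finset.filter_filter]
    exact Finset.filter_congr fun m _ => by tauto
  have hBP : ∀ l₁ l₂, bPlus (bPlus B₀ X l₁) X l₂ ≤ B₀ :=
    fun l₁ l₂ => (bPlus_le _ _ _).trans (bPlus_le _ _ _)
  have hBM : ∀ l₁ l₂, bMinus (bMinus B₀ X l₁) X l₂ ≤ B₀ :=
    fun l₁ l₂ => (bMinus_le _ _ _).trans (bMinus_le _ _ _)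
  constructor
  · -- Upper bound
    have hWle : (wsumG a b c X Msf n₁ n₂ : ℝ) ≤ ∑ m ∈ Msf, ∑ l₁ ∈ Finset.range (X / m + 1),
        ∑ l₂ ∈ Finset.range (X / m + 1), (wpairG a b c m n₁ n₂ l₁ l₂ : ℝ) := by
      unfold wsumG
      push_cast
      refine Finset.sum_le_sum fun m _ => ?_
      exact_mod_cast sum_xcountG_mul_le (a := a) (b := b) (c := c) X m n₁ n₂
    refine hWle.trans ?_
    rw [sum_sum_sum_range_comm Msf (fun m => X / m + 1) hL]
    have hmain : ∑ m ∈ Finset.Ioc A' B₀, ∑ l₁ ∈ Finset.range (X / m + 1),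
        ∑ l₂ ∈ Finset.range (X / m + 1), gfunG a b c (Nat.gcd n₁ n₂) l₁ l₂ =
        ∑ l₁ ∈ Finset.range (Lmax + 1), ∑ l₂ ∈ Finset.range (Lmax + 1),
          gfunG a b c (Nat.gcd n₁ n₂) l₁ l₂ * (((bPlus (bPlus B₀ X l₁) X l₂ - A' : ℕ) : ℝ)) := by
      rw [sum_sum_sum_range_comm (Finset.Ioc A' B₀) (fun m => X / m + 1) hLall]
      refine Finset.sum_congr rfl fun l₁ _ => Finset.sum_congr rfl fun l₂ _ => ?_
      rw [Finset.sum_const, nsmul_eq_mul, hIocP l₁ l₂, Nat.card_Ioc, mul_comm]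
    rw [hmain, Finset.mul_sum]
    have hstep : ∀ l₁ ∈ Finset.range (Lmax + 1),
        ∑ l₂ ∈ Finset.range (Lmax + 1), ∑ m ∈ Msf.filter (fun m => l₁ < X / m + 1 ∧ l₂ < X / m + 1),
            (wpairG a b c m n₁ n₂ l₁ l₂ : ℝ) ≤
          eκ * ∑ l₂ ∈ Finset.range (Lmax + 1),
              gfunG a b c (Nat.gcd n₁ n₂) l₁ l₂ * (((bPlus (bPlus B₀ X l₁) X l₂ - A' : ℕ) : ℝ)) +
            ((Lmax + 1 : ℕ) : ℝ) * Err := by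
      intro l₁ _
      have hin : ∀ l₂ ∈ Finset.range (Lmax + 1),
          ∑ m ∈ Msf.filter (fun m => l₁ < X / m + 1 ∧ l₂ < X / m + 1), (wpairG a b c m n₁ n₂ l₁ l₂ : ℝ) ≤
            eκ * (gfunG a b c (Nat.gcd n₁ n₂) l₁ l₂ * (((bPlus (bPlus B₀ X l₁) X l₂ - A' : ℕ) : ℝ))) + Err := by
        intro l₂ _
        rw [hfilP l₁ l₂]
        have h := hlayer l₁ l₂ (bPlus (bPlus B₀ X l₁) X l₂) (hBP l₁ l₂)
        have := (abs_le.mp h).2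
        linarith
      calc _ ≤ ∑ l₂ ∈ Finset.range (Lmax + 1),
            (eκ * (gfunG a b c (Nat.gcd n₁ n₂) l₁ l₂ * (((bPlus (bPlus B₀ X l₁) X l₂ - A' : ℕ) : ℝ))) + Err) :=
            Finset.sum_le_sum hin
        _ = _ := by
            rw [Finset.sum_add_distrib, Finset.sum_const, Finset.card_range, nsmul_eq_mul,
              ← Finset.mul_sum]
    calc _ ≤ ∑ l₁ ∈ Finset.range (Lmax + 1), (eκ * ∑ l₂ ∈ Finset.range (Lmax + 1),
              gfunG a b c (Nat.gcd n₁ n₂) l₁ l₂ * (((bPlus (bPlus B₀ X l₁) X l₂ - A' : ℕ) : ℝ)) +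
            ((Lmax + 1 : ℕ) : ℝ) * Err) := Finset.sum_le_sum hstep
      _ = _ := by
          rw [Finset.sum_add_distrib, Finset.sum_const, Finset.card_range, nsmul_eq_mul]
          push_cast
          ring
  · -- Lower bound
    have hWge : ∑ m ∈ Msf, ∑ l₁ ∈ Finset.range (X / m), ∑ l₂ ∈ Finset.range (X / m),
        (wpairG a b c m n₁ n₂ l₁ l₂ : ℝ) ≤ (wsumG a b c X Msf n₁ n₂ : ℝ) := by
      unfold wsumG
      push_cast
      refine Finset.sum_le_sum fun m hm => ?_
      have hm0 : 0 < m := by rw [hMsf, Finset.mem_filter, Finset.mem_Ioc] at hm; omega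
      exact_mod_cast le_sum_xcountG_mul_of_not_dvd (a := a) (b := b) X hm0 (hMs_ndvd m hm) n₁ n₂
    refine le_trans ?_ hWge
    rw [sum_sum_sum_range_comm Msf (fun m => X / m) hL']
    have hmain : ∑ m ∈ Finset.Ioc A' B₀, ∑ l₁ ∈ Finset.range (X / m),
        ∑ l₂ ∈ Finset.range (X / m), gfunG a b c (Nat.gcd n₁ n₂) l₁ l₂ =
        ∑ l₁ ∈ Finset.range (Lmax + 1), ∑ l₂ ∈ Finset.range (Lmax + 1),
          gfunG a b c (Nat.gcd n₁ n₂) l₁ l₂ * (((bMinus (bMinus B₀ X l₁) X l₂ - A' : ℕ) : ℝ)) := by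
      rw [sum_sum_sum_range_comm (Finset.Ioc A' B₀) (fun m => X / m) hLall']
      refine Finset.sum_congr rfl fun l₁ _ => Finset.sum_congr rfl fun l₂ _ => ?_
      rw [Finset.sum_const, nsmul_eq_mul, hIocM l₁ l₂, Nat.card_Ioc, mul_comm]
    rw [hmain, Finset.mul_sum]
    have hstep : ∀ l₁ ∈ Finset.range (Lmax + 1),
        eκ * ∑ l₂ ∈ Finset.range (Lmax + 1),
              gfunG a b c (Nat.gcd n₁ n₂) l₁ l₂ * (((bMinus (bMinus B₀ X l₁) X l₂ - A' : ℕ) : ℝ)) -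
            ((Lmax + 1 : ℕ) : ℝ) * Err ≤
          ∑ l₂ ∈ Finset.range (Lmax + 1), ∑ m ∈ Msf.filter (fun m => l₁ < X / m ∧ l₂ < X / m),
            (wpairG a b c m n₁ n₂ l₁ l₂ : ℝ) := by
      intro l₁ _
      have hin : ∀ l₂ ∈ Finset.range (Lmax + 1),
          eκ * (gfunG a b c (Nat.gcd n₁ n₂) l₁ l₂ * (((bMinus (bMinus B₀ X l₁) X l₂ - A' : ℕ) : ℝ))) - Err ≤
            ∑ m ∈ Msf.filter (fun m => l₁ < X / m ∧ l₂ < X / m), (wpairG a b c m n₁ n₂ l₁ l₂ : ℝ) := by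
        intro l₂ _
        rw [hfilM l₁ l₂]
        have h := hlayer l₁ l₂ (bMinus (bMinus B₀ X l₁) X l₂) (hBM l₁ l₂)
        have := (abs_le.mp h).1
        linarith
      calc _ = ∑ l₂ ∈ Finset.range (Lmax + 1),
            (eκ * (gfunG a b c (Nat.gcd n₁ n₂) l₁ l₂ * (((bMinus (bMinus B₀ X l₁) X l₂ - A' : ℕ) : ℝ))) - Err) := by
            rw [Finset.sum_sub_distrib, Finset.sum_const, Finset.card_range, nsmul_eq_mul,
              ← Finset.mul_sum]
        _ ≤ _ := Finset.sum_le_sum hin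
    calc _ = ∑ l₁ ∈ Finset.range (Lmax + 1), (eκ * ∑ l₂ ∈ Finset.range (Lmax + 1),
              gfunG a b c (Nat.gcd n₁ n₂) l₁ l₂ * (((bMinus (bMinus B₀ X l₁) X l₂ - A' : ℕ) : ℝ)) -
            ((Lmax + 1 : ℕ) : ℝ) * Err) := by
          rw [Finset.sum_sub_distrib, Finset.sum_const, Finset.card_range, nsmul_eq_mul]
          push_cast
          ring
      _ ≤ _ := Finset.sum_le_sum hstep


end Literature.NumberTheory.Sieve.Iwaniec1978

end
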